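import Mathlib.LinearAlgebra.Vandermonde
import Mathlib.LinearAlgebra.Matrix.NonsingularInverse
import Literature.Computability.AlgebraicComplexity.PartialMatrixMultiplication
import Literature.Computability.AlgebraicComplexity.AsymptoticSumInequality
import Literature.Computability.AlgebraicComplexity.TensorRestrictionRank
import HarnessLib

/-!
# Partial matrix multiplication restricts to total matrix multiplication (BCS 1997, Lemma (15.47))

Topic `Literature/Computability/AlgebraicComplexity`. First half of the PROOF of Schönhage's partial
matrix multiplication theorem `Schonhage1981_partialMatMul` (`PartialMatrixMultiplication.lean`;
Bürgisser–Clausen–Shokrollahi 1997, Thm. (15.48); the discharge `Schonhage1981_partialMatMul_holds`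
is in `PartialMatrixMultiplicationProofs.lean`), following the printed proof (BCS pp. 408–409):

* `tensorRestrictsTo_matMulTensor_of_pattern` — **Lemma (15.47)** in coordinates, with the middle
  restriction of the proof of Thm. (15.48) built in: if `T` is the partial matrix multiplication
  tensor of pattern `(I, J)` on row/middle/column index types `α, β, γ` and on a set `S ⊆ β` of
  middle indices the counts `#{i : (i,j) ∈ I} = M`, `#{k : (j,k) ∈ J} = P` are constant, then the
  TOTAL matrix multiplication tensor `⟨M, |S|, P⟩` is a restriction of `T`
  (`TensorRestrictsTo`, `AsymptoticSpectrum.lean`). BCS take a generic `α ∈ Hom(E, k^M)` injective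
  on every `⊕_{(i,j)∈I} E_i` ("certain minors do not vanish. As `k` is infinite, this is certainly
  possible"); we take the explicit Vandermonde matrix `α_{u i} = x_i^u` for an injective
  `x : α → K` (every `M × M` column minor is a Vandermonde determinant,
  `Matrix.det_vandermonde_ne_zero_iff`), so only an injection of the row index type into `K` is
  needed, and the inverse isomorphisms `(αΔ)⁻¹`, `(Δ_β)⁻¹` of the proof are the blockwise inverse
  Vandermonde matrices.
* `kroneckerPow_partialMatMulTensor_zip` — **(15.46)** for powers: read along the relabelling
  `((Fin N → Fin e) × (Fin N → Fin l)) → (Fin N → Fin e × Fin l)` (etc.), the `N`-th tensor power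
  `(⟨e,h,l⟩_{I,J})^{⊗N}` (`kroneckerPow`) is the partial matrix multiplication tensor of pattern
  `(I^N, J^N)`.
* `sum_dite_eq_sum_fin`, `partialMatMulTensor_apply` — bookkeeping.

## References

* [BurgisserClausenShokrollahi1997] P. Bürgisser, M. Clausen, M. A. Shokrollahi, *Algebraic
  Complexity Theory*, Springer 1997, §15.9: (15.46), Lemma (15.47) (pp. 408–409; held, read).
* [Schonhage1981] A. Schönhage, *Partial and total matrix multiplication*, SIAM J. Comput. 10
  (1981) 434–455 (the original of Thm. (15.48)).
-/

noncomputable section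

open scoped BigOperators

namespace Literature.Computability.AlgebraicComplexity

/-! ## Lemma (15.47): a total matrix multiplication inside a partial one -/

section Lemma1547

variable {K : Type*} [Field K]
variable {α β γ : Type*} [Fintype α] [Fintype β] [Fintype γ] [DecidableEq α] [DecidableEq β]
  [DecidableEq γ]

omit [DecidableEq α] in
/-- A sum of a `dite`-extended function over a finite type is the sum over the subtype, reindexed
along an enumeration `{a // P a} ≃ Fin n`. [folklore] -/
theorem sum_dite_eq_sum_fin {M₀ : Type*} [AddCommMonoid M₀] {P : α → Prop} [DecidablePred P]
    {n : ℕ} (e : {a // P a} ≃ Fin n) (g : {a // P a} → M₀) :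
    (∑ a, if h : P a then g ⟨a, h⟩ else 0) = ∑ w : Fin n, g (e.symm w) := by
  set F : α → M₀ := fun a => if h : P a then g ⟨a, h⟩ else 0 with hF
  have h1 : ∑ a, F a = ∑ a ∈ Finset.univ.filter P, F a := by
    refine (Finset.sum_subset (Finset.filter_subset _ _) fun a _ ha => ?_).symm
    have hPa : ¬ P a := fun hPa => ha (Finset.mem_filter.2 ⟨Finset.mem_univ _, hPa⟩)
    simp [hF, hPa]
  have h2 : ∑ a ∈ Finset.univ.filter P, F a = ∑ z : {a // P a}, F z.1 :=
    Finset.sum_subtype _ (fun a => by simp) F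
  rw [h1, h2]
  refine Fintype.sum_equiv e _ _ fun z => ?_
  simp [hF, z.2]

/-- **BCS Lemma (15.47) in coordinates** (with the middle restriction of the proof of Thm. (15.48)
built in). Let `T` be the partial matrix multiplication tensor of pattern `(I, J)` on
row/middle/column index types `α, β, γ`, let `S ⊆ β` be a set of middle indices on which the
column counts `m_j = #{i : (i,j) ∈ I} = M` and row counts `p_j = #{k : (j,k) ∈ J} = P` are
constant, and let `x : α → K`, `y : γ → K` be injective (they exist when `K` is infinite). Then
the TOTAL matrix multiplication tensor `⟨M, |S|, P⟩` is a restriction of `T`: with the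
Vandermonde matrix `α_{u i} = x_i^u` every `M × M` minor on columns `{i : (i,j) ∈ I}` is
invertible, so `φ ↦ α ∘ φ` is an isomorphism `Hom(H_S, E)_I → Hom(H_S, k^M)` (and dually for
`β`), and `(α ∘ φ) ∘ (ψ ∘ β) = α ∘ (φ ∘ ψ) ∘ β`.
[cite: BurgisserClausenShokrollahi1997, Lemma (15.47)] -/
theorem tensorRestrictsTo_matMulTensor_of_pattern (x : α → K) (hx : Function.Injective x)
    (y : γ → K) (hy : Function.Injective y) (I : Finset (α × β)) (J : Finset (β × γ))
    (T : α × γ → α × β → β × γ → K)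
    (hT : ∀ a b c, T a b c =
      if (b ∈ I ∧ c ∈ J) ∧ (a.1 = b.1 ∧ b.2 = c.1 ∧ a.2 = c.2) then 1 else 0)
    (S : Finset β) {M P : ℕ}
    (hM : ∀ j ∈ S, (Finset.univ.filter fun i => (i, j) ∈ I).card = M)
    (hP : ∀ j ∈ S, (Finset.univ.filter fun k => (j, k) ∈ J).card = P) :
    TensorRestrictsTo T (matMulTensor K M S.card P) := by
  -- enumerate `S`
  set σ : Fin S.card → β := fun c => (S.equivFin.symm c : β) with hσ
  have hσS : ∀ c, σ c ∈ S := fun c => (S.equivFin.symm c).2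
  have hσinj : Function.Injective σ := fun c c' h =>
    S.equivFin.symm.injective (Subtype.ext h)
  -- enumerations of the fibres over `σ c`
  have eI : ∀ c, {i // (i, σ c) ∈ I} ≃ Fin M := fun c =>
    (Equiv.subtypeEquivRight (fun i => by simp)).trans (Finset.equivFinOfCardEq (hM _ (hσS c)))
  have eJ : ∀ c, {k // (σ c, k) ∈ J} ≃ Fin P := fun c =>
    (Equiv.subtypeEquivRight (fun k => by simp)).trans (Finset.equivFinOfCardEq (hP _ (hσS c)))
  -- Vandermonde blocks
  set V : Fin S.card → Matrix (Fin M) (Fin M) K :=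
    fun c => (Matrix.vandermonde fun w => x ((eI c).symm w).1).transpose with hV
  set U : Fin S.card → Matrix (Fin P) (Fin P) K :=
    fun c => Matrix.vandermonde fun w => y ((eJ c).symm w).1 with hU
  have hVdet : ∀ c, IsUnit (V c).det := by
    intro c
    rw [isUnit_iff_ne_zero, hV, Matrix.det_transpose, Matrix.det_vandermonde_ne_zero_iff]
    exact hx.comp (Subtype.val_injective.comp (eI c).symm.injective)
  have hUdet : ∀ c, IsUnit (U c).det := by
    intro c
    rw [isUnit_iff_ne_zero, hU, Matrix.det_vandermonde_ne_zero_iff]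
    exact hy.comp (Subtype.val_injective.comp (eJ c).symm.injective)
  -- the three matrices of the restriction
  let A : Fin M × Fin P → α × γ → K := fun a' a => x a.1 ^ (a'.1 : ℕ) * y a.2 ^ (a'.2 : ℕ)
  let B : Fin M × Fin S.card → α × β → K := fun b' b =>
    if h : (b.1, σ b'.2) ∈ I then (if b.2 = σ b'.2 then (V b'.2)⁻¹ (eI b'.2 ⟨b.1, h⟩) b'.1 else 0)
    else 0
  let C : Fin S.card × Fin P → β × γ → K := fun c' c =>
    if h : (σ c'.1, c.2) ∈ J then (if c.1 = σ c'.1 then (U c'.1)⁻¹ c'.2 (eJ c'.1 ⟨c.2, h⟩) else 0)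
    else 0
  have hB0 : ∀ b' b, b.2 ≠ σ b'.2 → B b' b = 0 := by
    intro b' b hb
    simp only [B]
    split_ifs <;> rfl
  have hC0 : ∀ c' c, c.1 ≠ σ c'.1 → C c' c = 0 := by
    intro c' c hc
    simp only [C]
    split_ifs <;> rfl
  refine ⟨A, B, C, fun a' b' c' => ?_⟩
  obtain ⟨u, v⟩ := a'
  obtain ⟨u', c₁⟩ := b'
  obtain ⟨c₂, v'⟩ := c'
  -- collapse the `a`-sum with the Kronecker delta of `T`
  have hinner : ∀ b c, ∑ a, A (u, v) a * B (u', c₁) b * C (c₂, v') c * T a b c =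
      if (b ∈ I ∧ c ∈ J) ∧ b.2 = c.1 then A (u, v) (b.1, c.2) * B (u', c₁) b * C (c₂, v') c
      else 0 := by
    intro b c
    rw [Finset.sum_eq_single (b.1, c.2)]
    · rw [hT]
      by_cases h : (b ∈ I ∧ c ∈ J) ∧ b.2 = c.1
      · rw [if_pos ⟨h.1, rfl, h.2, rfl⟩, if_pos h, mul_one]
      · rw [if_neg (fun h' => h ⟨h'.1, h'.2.2.1⟩), if_neg h, mul_zero]
    · intro a _ ha
      rw [hT, if_neg, mul_zero]
      rintro ⟨-, h1, -, h3⟩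
      exact ha (Prod.ext h1 h3)
    · intro h
      exact absurd (Finset.mem_univ _) h
  have hreorder : ∑ a, ∑ b, ∑ c, A (u, v) a * B (u', c₁) b * C (c₂, v') c * T a b c =
      ∑ b, ∑ c, ∑ a, A (u, v) a * B (u', c₁) b * C (c₂, v') c * T a b c := by
    rw [Finset.sum_comm]
    exact Finset.sum_congr rfl fun b _ => Finset.sum_comm
  rw [hreorder]
  simp_rw [hinner]
  -- collapse the middle indices: `b = (i, σ c₁)`, `c = (σ c₂, k)`
  have hb : ∑ b : α × β, ∑ c : β × γ, (if (b ∈ I ∧ c ∈ J) ∧ b.2 = c.1 then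
        A (u, v) (b.1, c.2) * B (u', c₁) b * C (c₂, v') c else 0) =
      ∑ i : α, ∑ k : γ, (if ((i, σ c₁) ∈ I ∧ (σ c₂, k) ∈ J) ∧ σ c₁ = σ c₂ then
        A (u, v) (i, k) * B (u', c₁) (i, σ c₁) * C (c₂, v') (σ c₂, k) else 0) := by
    rw [Fintype.sum_prod_type]
    refine Finset.sum_congr rfl fun i _ => ?_
    rw [Finset.sum_eq_single (σ c₁)]
    · rw [Fintype.sum_prod_type]
      rw [Finset.sum_eq_single (σ c₂)]
      · intro j' _ hj'
        refine Finset.sum_eq_zero fun k _ => ?_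
        rw [hC0 (c₂, v') (j', k) hj']
        simp
      · intro h
        exact absurd (Finset.mem_univ _) h
    · intro j _ hj
      refine Finset.sum_eq_zero fun c _ => ?_
      rw [hB0 (u', c₁) (i, j) hj]
      simp
    · intro h
      exact absurd (Finset.mem_univ _) h
  rw [hb]
  by_cases hc : c₁ = c₂
  · subst hc
    -- the summand factors
    have hfac : ∀ i k, (if ((i, σ c₁) ∈ I ∧ (σ c₁, k) ∈ J) ∧ σ c₁ = σ c₁ then
          A (u, v) (i, k) * B (u', c₁) (i, σ c₁) * C (c₁, v') (σ c₁, k) else 0) =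
        (x i ^ (u : ℕ) * B (u', c₁) (i, σ c₁)) * (y k ^ (v : ℕ) * C (c₁, v') (σ c₁, k)) := by
      intro i k
      by_cases hi : (i, σ c₁) ∈ I
      · by_cases hk : (σ c₁, k) ∈ J
        · rw [if_pos ⟨⟨hi, hk⟩, rfl⟩]
          simp only [A]
          ring
        · have : C (c₁, v') (σ c₁, k) = 0 := by simp only [C, hk]; rfl
          rw [this, if_neg (fun h => hk h.1.2)]
          ring
      · have : B (u', c₁) (i, σ c₁) = 0 := by simp only [B, hi]; rfl
        rw [this, if_neg (fun h => hi h.1.1)]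
        ring
    rw [Finset.sum_congr rfl fun i _ => Finset.sum_congr rfl fun k _ => hfac i k]
    rw [← Finset.sum_mul_sum]
    -- the two Vandermonde identities
    have hVsum : ∑ i, x i ^ (u : ℕ) * B (u', c₁) (i, σ c₁) = if u = u' then 1 else 0 := by
      have h1 : ∀ i, x i ^ (u : ℕ) * B (u', c₁) (i, σ c₁) =
          if h : (i, σ c₁) ∈ I then x i ^ (u : ℕ) * (V c₁)⁻¹ (eI c₁ ⟨i, h⟩) u' else 0 := by
        intro i
        simp only [B]
        split_ifs with h
        · rfl
        · rw [mul_zero]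
      simp_rw [h1]
      rw [sum_dite_eq_sum_fin (eI c₁) (fun z => x z.1 ^ (u : ℕ) * (V c₁)⁻¹ (eI c₁ z) u')]
      simp only [Equiv.apply_symm_apply]
      have h2 : ∀ w, x ((eI c₁).symm w).1 ^ (u : ℕ) * (V c₁)⁻¹ w u' = V c₁ u w * (V c₁)⁻¹ w u' := by
        intro w
        simp [hV, Matrix.transpose_apply, Matrix.vandermonde_apply]
      simp_rw [h2]
      rw [← Matrix.mul_apply, Matrix.mul_nonsing_inv _ (hVdet c₁), Matrix.one_apply]
    have hUsum : ∑ k, y k ^ (v : ℕ) * C (c₁, v') (σ c₁, k) = if v' = v then 1 else 0 := by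
      have h1 : ∀ k, y k ^ (v : ℕ) * C (c₁, v') (σ c₁, k) =
          if h : (σ c₁, k) ∈ J then y k ^ (v : ℕ) * (U c₁)⁻¹ v' (eJ c₁ ⟨k, h⟩) else 0 := by
        intro k
        simp only [C]
        split_ifs with h
        · rfl
        · rw [mul_zero]
      simp_rw [h1]
      rw [sum_dite_eq_sum_fin (eJ c₁) (fun z => y z.1 ^ (v : ℕ) * (U c₁)⁻¹ v' (eJ c₁ z))]
      simp only [Equiv.apply_symm_apply]
      have h2 : ∀ w, y ((eJ c₁).symm w).1 ^ (v : ℕ) * (U c₁)⁻¹ v' w = (U c₁)⁻¹ v' w * U c₁ w v := by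
        intro w
        simp [hU, Matrix.vandermonde_apply, mul_comm]
      simp_rw [h2]
      rw [← Matrix.mul_apply, Matrix.nonsing_inv_mul _ (hUdet c₁), Matrix.one_apply]
    rw [hVsum, hUsum]
    simp only [matMulTensor]
    by_cases hu : u = u' <;> by_cases hv : v = v' <;> simp [hu, hv, eq_comm]
  · -- `c₁ ≠ c₂`: everything vanishes
    have hσc : σ c₁ ≠ σ c₂ := fun h => hc (hσinj h)
    simp only [matMulTensor, hc, false_and, and_false, if_false, hσc]
    simp

end Lemma1547

/-! ## Tensor powers of a partial matrix multiplication (BCS (15.46)) -/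

section Power

variable (K : Type*) [CommSemiring K]

/-- The entries of `⟨e, h, l⟩_{I,J}` as one indicator.
[cite: BurgisserClausenShokrollahi1997, §15.9] -/
theorem partialMatMulTensor_apply (e h l : ℕ) (I : Finset (Fin e × Fin h))
    (J : Finset (Fin h × Fin l)) (a : Fin e × Fin l) (b : Fin e × Fin h) (c : Fin h × Fin l) :
    partialMatMulTensor K e h l I J a b c =
      if (b ∈ I ∧ c ∈ J) ∧ (a.1 = b.1 ∧ b.2 = c.1 ∧ a.2 = c.2) then 1 else 0 := by
  unfold partialMatMulTensor matMulTensor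
  by_cases h1 : b ∈ I ∧ c ∈ J
  · by_cases h2 : a.1 = b.1 ∧ b.2 = c.1 ∧ a.2 = c.2
    · rw [if_pos h1, if_pos h2, if_pos ⟨h1, h2⟩]
    · rw [if_pos h1, if_neg h2, if_neg (fun h => h2 h.2)]
  · rw [if_neg h1, if_neg (fun h => h1 h.1)]

/-- **(15.46) in coordinates**: the `N`-th tensor power of `⟨e, h, l⟩_{I,J}`, read along the
relabelling `((Fin N → Fin e) × (Fin N → Fin l)) → (Fin N → Fin e × Fin l)` (and likewise in the
other two factors), is the partial matrix multiplication tensor of pattern `(I^N, J^N)` with row,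
middle and column index types `Fin N → Fin e`, `Fin N → Fin h`, `Fin N → Fin l`
(`⟨E^{⊗N}, H^{⊗N}, L^{⊗N}⟩_{I^N,J^N} ≃ (⟨E,H,L⟩_{I,J})^{⊗N}`).
[cite: BurgisserClausenShokrollahi1997, (15.46)] -/
theorem kroneckerPow_partialMatMulTensor_zip (e h l : ℕ) (I : Finset (Fin e × Fin h))
    (J : Finset (Fin h × Fin l)) (N : ℕ)
    (a : (Fin N → Fin e) × (Fin N → Fin l)) (b : (Fin N → Fin e) × (Fin N → Fin h))
    (c : (Fin N → Fin h) × (Fin N → Fin l)) :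
    kroneckerPow (partialMatMulTensor K e h l I J) N (fun s => (a.1 s, a.2 s))
        (fun s => (b.1 s, b.2 s)) (fun s => (c.1 s, c.2 s)) =
      if (b ∈ (Finset.univ.filter fun q : (Fin N → Fin e) × (Fin N → Fin h) =>
              ∀ s, (q.1 s, q.2 s) ∈ I) ∧
            c ∈ (Finset.univ.filter fun q : (Fin N → Fin h) × (Fin N → Fin l) =>
              ∀ s, (q.1 s, q.2 s) ∈ J)) ∧
          (a.1 = b.1 ∧ b.2 = c.1 ∧ a.2 = c.2) then 1 else 0 := by
  rw [kroneckerPow_apply]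
  simp_rw [partialMatMulTensor_apply]
  rw [Finset.prod_boole]
  refine ite_congr_prop ?_
  simp only [Finset.mem_univ, forall_const, Finset.mem_filter, true_and,
    funext_iff, forall_and]

end Power

end Literature.Computability.AlgebraicComplexity

end
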